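import Literature.Topology.FourManifolds.VerticaliseNearCorner
import Literature.Topology.FourManifolds.RegularFamilyIsotopy
import Literature.Topology.FourManifolds.CappedBallLid
import Literature.Topology.FourManifolds.AlexanderTools
import Literature.Topology.FourManifolds.SubsphereSide
import HarnessLib

/-!
# The tube normal form at the unit level circle

Topic `Literature/Topology/FourManifolds`; fact seat of Alexander's theorem
(`provefact-Literature.Topology.FourManifolds.SphereEmbedding.schoenflies_exists_ball`, Schultens
(2014), Thm. 3.2.5).  **Everything in this file is proved; no definitions, no named facts.**

After the planar normalisation (`PlanarNormalise.lean`) the innermost level circle of the surface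
`{F = 0}` is the unit circle `C₀ = {x₀² + x₁² = 1, x₂ = 0}`, isolated in the plane `{x₂ = 0}`,
with `σF < 0` on the open unit disc (`σ = ±1`) and `F` transverse to the levels along
`{F = 0} ∩ {x₂ = 0}`.  This file straightens the surface near `C₀` to the **vertical unit
cylinder** and the defining function to the **tube normal form** `σ(x₀² + x₁² - 1)` of the
capped-ball step (`CappedBallData.StepNF.hNF`):

* `CircleNormalForm.exists_tubeNormalForm` — a diffeomorphism `Φ` of `ℝ³`
  (`Verticalise.exists_verticalise` at `C₀`) and a smooth proper regular `F♯` with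
  `Φ({F ≤ 0}) = {F♯ ≤ 0}`, `Φ({F = 0}) = {F♯ = 0}`, `F♯ = σ(x₀² + x₁² - 1)` on a tube
  `{x₀² + x₁² ≤ (1 + 3w₀)², |x₂| ≤ η₀}`, the level-`0` zero set unchanged, and a closed
  "modification zone" `M` off which `Φ = id` and `F♯ = F`, inside which neither `F` nor `F♯` has a
  horizontal zero (so the critical points of the height on the surface, their germs and their
  values are untouched).

Schultens (2014), proof of Thm. 3.2.5 (PDF p. 45), uses the disc `D ⊂ H'` with `D ∩ S = α` and
Lemma 3.2.3's product neighbourhood `S̃ × I` of the surface near `α`; the tube normal form is this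
product structure made explicit.

## References
* J. Schultens, *Introduction to 3-Manifolds*, GSM 151, AMS (2014), Lemma 3.2.3 and proof of
  Thm. 3.2.5 (PDF pp. 42–45).
-/

noncomputable section

open Set Metric Filter Topology Function Module
open scoped ContDiff RealInnerProductSpace Manifold

namespace Literature.Topology.FourManifolds.CircleNormalForm

open CappedBallLid

/-! ### §1 The unit circle in the plane `{x₂ = 0}` -/

/-- The norm of a horizontal point is `√(x₀² + x₁²)`. [folklore] -/
theorem norm_eq_sqrt_hsq {x : EuclideanSpace ℝ (Fin 3)} (hx : x 2 = 0) : ‖x‖ = Real.sqrt (hsq x) := by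
  rw [EuclideanSpace.norm_eq, hsq]
  congr 1
  simp [Fin.sum_univ_three, hx, sq_abs]

/-- The unit circle `C₀ = {x₀² + x₁² = 1, x₂ = 0}` is compact. [folklore] -/
theorem isCompact_circle : IsCompact {x : EuclideanSpace ℝ (Fin 3) | hsq x = 1 ∧ x 2 = 0} := by
  refine Metric.isCompact_of_isClosed_isBounded ?_ ?_
  · exact (isClosed_eq ((contDiff_hsq (n := ∞)).continuous) continuous_const).inter
      (isClosed_eq (PiLp.continuous_apply 2 _ (2 : Fin 3)) continuous_const)
  · refine (Metric.isBounded_closedBall (x := (0 : EuclideanSpace ℝ (Fin 3))) (r := 1)).subset ?_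
    rintro x ⟨hx1, hx2⟩
    rw [mem_closedBall_zero_iff, norm_eq_sqrt_hsq hx2, hx1, Real.sqrt_one]

/-- **Distance to the unit circle** of a horizontal point: `infDist x C₀ = |√(x₀² + x₁²) - 1|`.
[folklore] -/
theorem infDist_circle {x : EuclideanSpace ℝ (Fin 3)} (hx : x 2 = 0) :
    infDist x {y : EuclideanSpace ℝ (Fin 3) | hsq y = 1 ∧ y 2 = 0} = |Real.sqrt (hsq x) - 1| := by
  set C : Set (EuclideanSpace ℝ (Fin 3)) := {y | hsq y = 1 ∧ y 2 = 0} with hC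
  have hCne : C.Nonempty := ⟨EuclideanSpace.single 0 1, by simp [hsq], by simp⟩
  apply le_antisymm
  · -- a point of `C` at that distance
    set r := Real.sqrt (hsq x) with hr
    have hr0 : 0 ≤ r := Real.sqrt_nonneg _
    have hnx : ‖x‖ = r := norm_eq_sqrt_hsq hx
    by_cases h0 : r = 0
    · have hx0 : x = 0 := by rw [← norm_eq_zero, hnx, h0]
      have : infDist x C ≤ dist x (EuclideanSpace.single 0 1) :=
        infDist_le_dist_of_mem (by exact ⟨by simp [hsq], by simp⟩)
      rw [hx0, h0] at *
      simpa using this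
    · have hrpos : 0 < r := lt_of_le_of_ne hr0 (Ne.symm h0)
      set c : EuclideanSpace ℝ (Fin 3) := r⁻¹ • x with hc
      have hcC : c ∈ C := by
        refine ⟨?_, by simp [hc, hx]⟩
        have : hsq c = r⁻¹ ^ 2 * hsq x := by simp [hsq, hc, mul_pow]; ring
        rw [this, show hsq x = r ^ 2 from (Real.sq_sqrt (hsq_nonneg x)).symm]
        field_simp
      refine (infDist_le_dist_of_mem hcC).trans (le_of_eq ?_)
      rw [dist_eq_norm, hc, show x - r⁻¹ • x = (1 - r⁻¹) • x by rw [sub_smul, one_smul], norm_smul, hnx,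
        Real.norm_eq_abs]
      rw [show (1 - r⁻¹) = (r - 1) * r⁻¹ by field_simp, abs_mul, abs_of_pos (inv_pos.2 hrpos),
        mul_assoc, inv_mul_cancel₀ h0, mul_one]
  · -- every point of `C` is at least that far
    refine (le_infDist hCne).2 ?_
    rintro y ⟨hy1, hy2⟩
    rw [dist_eq_norm]
    have hny : ‖y‖ = 1 := by rw [norm_eq_sqrt_hsq hy2, hy1, Real.sqrt_one]
    have := abs_norm_sub_norm_le x y
    rw [norm_eq_sqrt_hsq hx, hny] at this
    exact this

/-- The outer/inner annuli around the unit circle in the plane are preconnected: the horizontal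
annulus `{r₁² < x₀² + x₁² < r₂², x₂ = 0}` (`0 ≤ r₁, r₂`) is the image of `(r₁, r₂) × ℝ` under
`(r, θ) ↦ (r cos θ, r sin θ, 0)`. [folklore] -/
theorem isPreconnected_annulus {r₁ r₂ : ℝ} (hr₁ : 0 ≤ r₁) (hr₂ : 0 ≤ r₂) :
    IsPreconnected {x : EuclideanSpace ℝ (Fin 3) | r₁ ^ 2 < hsq x ∧ hsq x < r₂ ^ 2 ∧ x 2 = 0} := by
  set g : ℝ × ℝ → EuclideanSpace ℝ (Fin 3) := fun p =>
    (p.1 * Real.cos p.2) • EuclideanSpace.single 0 1 + (p.1 * Real.sin p.2) • EuclideanSpace.single 1 1 with hg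
  have hgc : Continuous g := by
    simp only [hg]
    exact ((continuous_fst.mul (Real.continuous_cos.comp continuous_snd)).smul continuous_const).add
      ((continuous_fst.mul (Real.continuous_sin.comp continuous_snd)).smul continuous_const)
  have hg0 : ∀ p, g p 0 = p.1 * Real.cos p.2 := fun p => by simp [hg]
  have hg1 : ∀ p, g p 1 = p.1 * Real.sin p.2 := fun p => by simp [hg]
  have hg2 : ∀ p, g p 2 = 0 := fun p => by simp [hg]
  have hgh : ∀ p, hsq (g p) = p.1 ^ 2 := fun p => by
    rw [hsq, hg0, hg1]; nlinarith [Real.cos_sq_add_sin_sq p.2]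
  have heq : {x : EuclideanSpace ℝ (Fin 3) | r₁ ^ 2 < hsq x ∧ hsq x < r₂ ^ 2 ∧ x 2 = 0} = g '' (Ioo r₁ r₂ ×ˢ univ) := by
    ext x
    constructor
    · rintro ⟨h1, h2, h3⟩
      have hpos : 0 < hsq x := lt_of_le_of_lt (sq_nonneg _) h1
      set r := Real.sqrt (hsq x) with hr
      have hrpos : 0 < r := Real.sqrt_pos.2 hpos
      have hr2 : r ^ 2 = hsq x := Real.sq_sqrt hpos.le
      -- the angle
      have hcs : (x 0 / r) ^ 2 + (x 1 / r) ^ 2 = 1 := by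
        field_simp; rw [hr2, hsq]
      obtain ⟨θ, hθc, hθs⟩ : ∃ θ, Real.cos θ = x 0 / r ∧ Real.sin θ = x 1 / r := by
        have habs : |x 0 / r| ≤ 1 := by
          rw [abs_le]; constructor <;> nlinarith [sq_nonneg (x 1 / r)]
        rcases le_or_gt 0 (x 1 / r) with hs | hs
        · refine ⟨Real.arccos (x 0 / r), Real.cos_arccos (by linarith [abs_le.1 habs |>.1]) (abs_le.1 habs).2, ?_⟩
          rw [Real.sin_arccos]
          have : 1 - (x 0 / r) ^ 2 = (x 1 / r) ^ 2 := by linarith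
          rw [this, Real.sqrt_sq hs]
        · refine ⟨-Real.arccos (x 0 / r), by rw [Real.cos_neg]; exact Real.cos_arccos (abs_le.1 habs).1 (abs_le.1 habs).2, ?_⟩
          rw [Real.sin_neg, Real.sin_arccos]
          have : 1 - (x 0 / r) ^ 2 = (x 1 / r) ^ 2 := by linarith
          rw [this, Real.sqrt_sq_eq_abs, abs_of_neg hs]; ring
      refine ⟨(r, θ), ⟨⟨?_, ?_⟩, mem_univ _⟩, ?_⟩
      · nlinarith [Real.sqrt_nonneg (hsq x), Real.sq_sqrt hpos.le]
      · exact lt_of_pow_lt_pow_left₀ 2 hr₂ (by rw [hr2]; exact h2)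
      · ext i; fin_cases i
        · show g (r, θ) 0 = x 0
          rw [hg0]; simp only; rw [hθc]; field_simp
        · show g (r, θ) 1 = x 1
          rw [hg1]; simp only; rw [hθs]; field_simp
        · show g (r, θ) 2 = x 2
          rw [hg2, h3]
    · rintro ⟨⟨r, θ⟩, ⟨⟨h1, h2⟩, -⟩, rfl⟩
      refine ⟨?_, ?_, hg2 _⟩
      · rw [hgh]; exact pow_lt_pow_left₀ h1 hr₁ two_ne_zero
      · rw [hgh]; exact pow_lt_pow_left₀ h2 (hr₁.trans h1.le) two_ne_zero
  rw [heq]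
  exact (isPreconnected_Ioo.prod isPreconnected_univ).image _ hgc.continuousOn


/-! ### §2 Derivatives at the unit circle -/

/-- **A covector killing the radial and tangent directions at a circle point is horizontal.**
For `c` on the unit circle, if `A c = 0` and `A (Jc) = 0` (`Jc = (-c₁, c₀, 0)`), then
`A = (A e₂) ⟪e₂, ·⟫`. [folklore] -/
theorem eq_smul_innerSL_of_radial_tangent {c : EuclideanSpace ℝ (Fin 3)} (hc : hsq c = 1) (hc2 : c 2 = 0)
    {A : EuclideanSpace ℝ (Fin 3) →L[ℝ] ℝ} (hr : A c = 0)
    (ht : A ((-c 1) • EuclideanSpace.single 0 1 + (c 0) • EuclideanSpace.single 1 1) = 0) :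
    A = (A (EuclideanSpace.single 2 1)) • innerSL ℝ (EuclideanSpace.single (2 : Fin 3) (1 : ℝ)) := by
  set e₀ : EuclideanSpace ℝ (Fin 3) := EuclideanSpace.single 0 1 with he₀
  set e₁ : EuclideanSpace ℝ (Fin 3) := EuclideanSpace.single 1 1 with he₁
  set v : EuclideanSpace ℝ (Fin 3) := EuclideanSpace.single 2 1 with hv
  have hcdec : c = (c 0) • e₀ + (c 1) • e₁ := by
    ext i; fin_cases i <;> simp [he₀, he₁, hc2]
  have hA0 : A e₀ = 0 := by
    have : e₀ = (c 0) • c - (c 1) • ((-c 1) • e₀ + (c 0) • e₁) := by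
      rw [hcdec]; ext i; fin_cases i
      · simp [he₀, he₁]; rw [hsq] at hc; nlinarith
      · simp [he₀, he₁]; ring
      · simp [he₀, he₁]
    rw [this, map_sub, map_smul, map_smul, hr, ht]; simp
  have hA1 : A e₁ = 0 := by
    have : e₁ = (c 1) • c + (c 0) • ((-c 1) • e₀ + (c 0) • e₁) := by
      rw [hcdec]; ext i; fin_cases i
      · simp [he₀, he₁]; ring
      · simp [he₀, he₁]; rw [hsq] at hc; nlinarith
      · simp [he₀, he₁]
    rw [this, map_add, map_smul, map_smul, hr, ht]; simp
  ext u
  have hu : u = (u 0) • e₀ + (u 1) • e₁ + (u 2) • v := by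
    ext i; fin_cases i <;> simp [he₀, he₁, hv]
  conv_lhs => rw [hu]
  rw [map_add, map_add, map_smul, map_smul, map_smul, hA0, hA1]
  simp [hv, EuclideanSpace.inner_single_left, mul_comm]

/-- **The tangential derivative vanishes along the zero circle**: if `F = 0` on the unit circle
then `DF(c)(Jc) = 0` at each of its points. [folklore] -/
theorem fderiv_tangent_eq_zero {F : EuclideanSpace ℝ (Fin 3) → ℝ} (hF : Differentiable ℝ F)
    (hcirc : ∀ x : EuclideanSpace ℝ (Fin 3), hsq x = 1 → x 2 = 0 → F x = 0)
    {c : EuclideanSpace ℝ (Fin 3)} (hc : hsq c = 1) (hc2 : c 2 = 0) :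
    fderiv ℝ F c ((-c 1) • EuclideanSpace.single 0 1 + (c 0) • EuclideanSpace.single 1 1) = 0 := by
  set J : EuclideanSpace ℝ (Fin 3) := (-c 1) • EuclideanSpace.single 0 1 + (c 0) • EuclideanSpace.single 1 1 with hJ
  -- the curve `θ ↦ cos θ c + sin θ Jc` lies on the circle
  set γ : ℝ → EuclideanSpace ℝ (Fin 3) := fun θ => Real.cos θ • c + Real.sin θ • J with hγ
  have hγ0 : ∀ θ, γ θ 0 = Real.cos θ * c 0 - Real.sin θ * c 1 := fun θ => by simp [hγ, hJ]; ring
  have hγ1 : ∀ θ, γ θ 1 = Real.cos θ * c 1 + Real.sin θ * c 0 := fun θ => by simp [hγ, hJ]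
  have hγ2 : ∀ θ, γ θ 2 = 0 := fun θ => by simp [hγ, hJ, hc2]
  have hγh : ∀ θ, hsq (γ θ) = 1 := fun θ => by
    rw [hsq, hγ0, hγ1]; rw [hsq] at hc
    nlinarith [Real.cos_sq_add_sin_sq θ]
  have hconst : ∀ θ, F (γ θ) = 0 := fun θ => hcirc _ (hγh θ) (hγ2 θ)
  have hγd : HasDerivAt γ J 0 := by
    have h1 : HasDerivAt (fun θ => Real.cos θ • c) ((-Real.sin 0) • c) 0 := (Real.hasDerivAt_cos 0).smul_const c
    have h2 : HasDerivAt (fun θ => Real.sin θ • J) ((Real.cos 0) • J) 0 := (Real.hasDerivAt_sin 0).smul_const J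
    have h3 : HasDerivAt (fun θ => Real.cos θ • c + Real.sin θ • J) ((-Real.sin 0) • c + (Real.cos 0) • J) 0 := h1.add h2
    simp only [Real.sin_zero, neg_zero, zero_smul, Real.cos_zero, one_smul, zero_add] at h3
    exact h3
  have hγ00 : γ 0 = c := by simp [hγ]
  have hcomp : HasDerivAt (fun θ => F (γ θ)) (fderiv ℝ F c J) 0 := by
    have := (hF (γ 0)).hasFDerivAt.comp_hasDerivAt (0 : ℝ) hγd
    rw [hγ00] at this; exact this
  have hzero : HasDerivAt (fun θ => F (γ θ)) 0 0 := by
    have : (fun θ => F (γ θ)) = fun _ => 0 := funext hconst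
    rw [this]; exact hasDerivAt_const 0 0
  exact hcomp.unique hzero

/-- The radial function `t ↦ F (t c)` has derivative `DF(t c)(c)`. [folklore] -/
theorem hasDerivAt_radial {F : EuclideanSpace ℝ (Fin 3) → ℝ} (hF : Differentiable ℝ F)
    (c : EuclideanSpace ℝ (Fin 3)) (t : ℝ) :
    HasDerivAt (fun t : ℝ => F (t • c)) (fderiv ℝ F (t • c) c) t := by
  have hl : HasDerivAt (fun t : ℝ => t • c) c t := by simpa using (hasDerivAt_id t).smul_const c
  exact (hF _).hasFDerivAt.comp_hasDerivAt t hl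

section Sign

variable {F : EuclideanSpace ℝ (Fin 3) → ℝ} (hF : ContDiff ℝ ∞ F)
  (hcirc : ∀ x : EuclideanSpace ℝ (Fin 3), hsq x = 1 → x 2 = 0 → F x = 0)
  {ρ₁ : ℝ} (hρ₁ : 0 < ρ₁)
  (hiso : ∀ x : EuclideanSpace ℝ (Fin 3), F x = 0 → x 2 = 0 → hsq x < (1 + ρ₁) ^ 2 → hsq x = 1)
  {σ : ℝ} (hσ : σ = 1 ∨ σ = -1)
  (hin : ∀ x : EuclideanSpace ℝ (Fin 3), hsq x < 1 → x 2 = 0 → σ * F x < 0)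
  (htr : ∀ x : EuclideanSpace ℝ (Fin 3), F x = 0 → x 2 = 0 → ∀ c : ℝ,
    fderiv ℝ F x ≠ c • innerSL ℝ (EuclideanSpace.single (2 : Fin 3) (1 : ℝ)))
include hF hcirc hρ₁ hiso hσ hin htr

/-- **Sign outside the circle**: `σF > 0` on the outer annulus `{1 < ρ² < (1 + ρ₁)², x₂ = 0}`
(it is connected and zero-free; were `σF` negative there, the circle would consist of local
maxima of `σF` on the plane, making `DF` horizontal). [folklore] -/
theorem pos_outer {x : EuclideanSpace ℝ (Fin 3)} (h1 : 1 < hsq x) (h2 : hsq x < (1 + ρ₁) ^ 2) (hx2 : x 2 = 0) :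
    0 < σ * F x := by
  have hFd : Differentiable ℝ F := hF.differentiable (by simp)
  have hσ0 : σ ≠ 0 := by rcases hσ with h | h <;> rw [h] <;> norm_num
  set A : Set (EuclideanSpace ℝ (Fin 3)) := {y | (1 : ℝ) ^ 2 < hsq y ∧ hsq y < (1 + ρ₁) ^ 2 ∧ y 2 = 0} with hA
  have hAc : IsPreconnected A := isPreconnected_annulus zero_le_one (by linarith)
  have hcont : ContinuousOn (fun y => σ * F y) A := (continuous_const.mul hF.continuous).continuousOn
  have hne : ∀ y ∈ A, σ * F y ≠ 0 := by
    rintro y ⟨hy1, hy2, hy3⟩ h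
    have hF0 : F y = 0 := by rcases mul_eq_zero.1 h with h | h; exacts [absurd h hσ0, h]
    have := hiso y hF0 hy3 hy2
    rw [this] at hy1; norm_num at hy1
  have hxA : x ∈ A := ⟨by simpa using h1, h2, hx2⟩
  rcases AlexanderTools.forall_pos_or_forall_neg hAc hcont hne with hpos | hneg
  · exact hpos x hxA
  · exfalso
    -- the point `e₀` of the circle is a local maximum of `t ↦ σ F (t e₀)`
    set e₀ : EuclideanSpace ℝ (Fin 3) := EuclideanSpace.single 0 1 with he₀
    have he₀h : hsq e₀ = 1 := by simp [he₀, hsq]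
    have he₀2 : e₀ 2 = 0 := by simp [he₀]
    have hth : ∀ t : ℝ, hsq (t • e₀) = t ^ 2 := fun t => by simp [hsq, he₀]
    have ht2 : ∀ t : ℝ, (t • e₀) 2 = 0 := fun t => by simp [he₀]
    have hmax : IsLocalMax (fun t : ℝ => σ * F (t • e₀)) 1 := by
      have h0 : σ * F ((1 : ℝ) • e₀) = 0 := by rw [one_smul, hcirc e₀ he₀h he₀2, mul_zero]
      filter_upwards [Ioo_mem_nhds (show (0 : ℝ) < 1 by norm_num) (show (1 : ℝ) < 1 + ρ₁ by linarith)] with t ht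
      rw [h0]
      rcases lt_trichotomy t 1 with hlt | rfl | hgt
      · exact (hin _ (by rw [hth]; nlinarith [ht.1]) (ht2 t)).le
      · rw [one_smul, hcirc e₀ he₀h he₀2, mul_zero]
      · exact (hneg _ ⟨by rw [hth]; nlinarith, by rw [hth]; nlinarith [ht.2], ht2 t⟩).le
    have hder := hmax.hasDerivAt_eq_zero ((hasDerivAt_radial hFd e₀ 1).const_mul σ)
    rw [one_smul] at hder
    have hr : fderiv ℝ F e₀ e₀ = 0 := by
      rcases mul_eq_zero.1 hder with h | h; exacts [absurd h hσ0, h]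
    have htan := fderiv_tangent_eq_zero hFd hcirc he₀h he₀2
    exact htr e₀ (hcirc e₀ he₀h he₀2) he₀2 _ (eq_smul_innerSL_of_radial_tangent he₀h he₀2 hr htan)

/-- **The outward radial derivative of `σF` at a circle point is positive.** [folklore] -/
theorem radial_pos {c : EuclideanSpace ℝ (Fin 3)} (hc : hsq c = 1) (hc2 : c 2 = 0) : 0 < σ * fderiv ℝ F c c := by
  have hFd : Differentiable ℝ F := hF.differentiable (by simp)
  have hσ0 : σ ≠ 0 := by rcases hσ with h | h <;> rw [h] <;> norm_num
  have hth : ∀ t : ℝ, hsq (t • c) = t ^ 2 := fun t => by simp [hsq, mul_pow]; rw [hsq] at hc; nlinarith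
  have ht2 : ∀ t : ℝ, (t • c) 2 = 0 := fun t => by simp [hc2]
  rcases lt_trichotomy (σ * fderiv ℝ F c c) 0 with hlt | heq | hgt
  · exfalso
    -- then `σF < 0` just outside the circle along the ray, contradicting `pos_outer`
    have hH : Differentiable ℝ (fun y => σ * F y) := hFd.const_mul σ
    have hDH : fderiv ℝ (fun y => σ * F y) c c = σ * fderiv ℝ F c c := by
      rw [fderiv_const_mul (hFd c)]; rfl
    have hev := ExpHeight.exists_pos_apply_add_smul_neg hH (by show σ * F c = 0; rw [hcirc c hc hc2, mul_zero])
      (by rw [hDH]; exact hlt)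
    obtain ⟨t, ht, htI⟩ := (hev.and (Ioo_mem_nhdsGT hρ₁)).exists
    have heq : c + t • c = (1 + t) • c := by rw [add_smul, one_smul]
    rw [heq] at ht
    have := pos_outer hF hcirc hρ₁ hiso hσ hin htr (x := (1 + t) • c) (by rw [hth]; nlinarith [htI.1])
      (by rw [hth]; nlinarith [htI.1, htI.2]) (ht2 _)
    linarith
  · exfalso
    have hr : fderiv ℝ F c c = 0 := by rcases mul_eq_zero.1 heq with h | h; exacts [absurd h hσ0, h]
    exact htr c (hcirc c hc hc2) hc2 _ (eq_smul_innerSL_of_radial_tangent hc hc2 hr (fderiv_tangent_eq_zero hFd hcirc hc hc2))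
  · exact hgt

end Sign

/-! ### §3 The tube normal form -/

set_option maxHeartbeats 4000000 in
/-- **The tube normal form at the unit level circle** (see the module docstring).
[cite: Schultens2014, Lemma 3.2.3 and proof of Thm. 3.2.5 (PDF pp. 42–45)] -/
theorem exists_tubeNormalForm {F : EuclideanSpace ℝ (Fin 3) → ℝ} (hF : ContDiff ℝ ∞ F)
    {K : Set (EuclideanSpace ℝ (Fin 3))} (hK : IsCompact K) {ε₀ : ℝ} (hε₀ : 0 < ε₀)
    (hKF : ∀ x, F x ≤ ε₀ → x ∈ K) (hreg : ∀ x, F x = 0 → fderiv ℝ F x ≠ 0)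
    (hcirc : ∀ x : EuclideanSpace ℝ (Fin 3), hsq x = 1 → x 2 = 0 → F x = 0)
    {ρ₁ : ℝ} (hρ₁ : 0 < ρ₁)
    (hiso : ∀ x : EuclideanSpace ℝ (Fin 3), F x = 0 → x 2 = 0 → hsq x < (1 + ρ₁) ^ 2 → hsq x = 1)
    {σ : ℝ} (hσ : σ = 1 ∨ σ = -1)
    (hin : ∀ x : EuclideanSpace ℝ (Fin 3), hsq x < 1 → x 2 = 0 → σ * F x < 0)
    (htr : ∀ x : EuclideanSpace ℝ (Fin 3), F x = 0 → x 2 = 0 → ∀ c : ℝ,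
      fderiv ℝ F x ≠ c • innerSL ℝ (EuclideanSpace.single (2 : Fin 3) (1 : ℝ))) :
    ∃ (G : EuclideanSpace ℝ (Fin 3) → ℝ)
      (Φ : EuclideanSpace ℝ (Fin 3) ≃ₘ⟮𝓘(ℝ, EuclideanSpace ℝ (Fin 3)), 𝓘(ℝ, EuclideanSpace ℝ (Fin 3))⟯ EuclideanSpace ℝ (Fin 3))
      (w₀ η₀ : ℝ) (K' M : Set (EuclideanSpace ℝ (Fin 3))),
      0 < w₀ ∧ 0 < η₀ ∧ ContDiff ℝ ∞ G ∧ IsCompact K' ∧ (∀ x, G x ≤ ε₀ → x ∈ K') ∧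
      (∀ x, G x = 0 → fderiv ℝ G x ≠ 0) ∧
      Φ '' {x | F x ≤ 0} = {x | G x ≤ 0} ∧ Φ '' {x | F x = 0} = {x | G x = 0} ∧
      (∀ x, hsq x ≤ (1 + 3 * w₀) ^ 2 → |x 2| ≤ η₀ → G x = σ * (hsq x - 1)) ∧
      (∀ x : EuclideanSpace ℝ (Fin 3), x 2 = 0 → (G x = 0 ↔ F x = 0)) ∧
      IsClosed M ∧ (∀ x, x ∉ M → Φ x = x) ∧ (∀ x, x ∉ M → G x = F x) ∧
      (∀ x ∈ M, F x = 0 → ∀ c : ℝ, fderiv ℝ F x ≠ c • innerSL ℝ (EuclideanSpace.single (2 : Fin 3) (1 : ℝ))) ∧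
      (∀ x ∈ M, G x = 0 → ∀ c : ℝ, fderiv ℝ G x ≠ c • innerSL ℝ (EuclideanSpace.single (2 : Fin 3) (1 : ℝ))) := by
  set v : EuclideanSpace ℝ (Fin 3) := EuclideanSpace.single (2 : Fin 3) (1 : ℝ) with hv
  have hv0 : v ≠ 0 := by
    intro h; have := congrArg (fun w : EuclideanSpace ℝ (Fin 3) => w 2) h; simp [hv] at this
  have hv1 : ‖v‖ = 1 := by simp [hv]
  have hvin : ∀ x : EuclideanSpace ℝ (Fin 3), ⟪v, x⟫ = x 2 := fun x => by simp [hv, EuclideanSpace.inner_single_left]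
  have hFd : Differentiable ℝ F := hF.differentiable (by simp)
  have hσ0 : σ ≠ 0 := by rcases hσ with h | h <;> rw [h] <;> norm_num
  have hσ2 : σ * σ = 1 := by rcases hσ with h | h <;> rw [h] <;> norm_num
  -- the circle and the verticalisation
  set C₀ : Set (EuclideanSpace ℝ (Fin 3)) := {x | hsq x = 1 ∧ x 2 = 0} with hC₀
  have hC₀c : IsCompact C₀ := isCompact_circle
  have hC₀ne : C₀.Nonempty := ⟨EuclideanSpace.single 0 1, by simp [hsq], by simp⟩
  have hT : ∀ x ∈ C₀, ∀ c : ℝ, fderiv ℝ F x ≠ c • innerSL ℝ v := fun x hx c => htr x (hcirc x hx.1 hx.2) hx.2 c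
  obtain ⟨ρ, hρ, η, hη, F₁, hF₁s, hF₁reg, hF₁K, hF₁lev, hF₁out, hF₁Dout, hF₁in, hF₁tr, hFtr, Φ, hΦle, hΦeq, hΦout⟩ :=
    Verticalise.exists_verticalise hF hK hε₀ hKF hreg hv0 (a := 0) hC₀c hT
  -- the level projection
  set pr : EuclideanSpace ℝ (Fin 3) → EuclideanSpace ℝ (Fin 3) := fun x => x - ((⟪v, x⟫ - 0) / ‖v‖ ^ 2) • v with hpr
  have hpr_eq : ∀ x, pr x = x - (x 2) • v := fun x => by simp only [hpr, hvin, hv1, sub_zero, one_pow, div_one]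
  have hpr2 : ∀ x, (pr x) 2 = 0 := fun x => by rw [hpr_eq]; simp [hv]
  have hpr0 : ∀ x, (pr x) 0 = x 0 := fun x => by rw [hpr_eq]; simp [hv]
  have hpr1 : ∀ x, (pr x) 1 = x 1 := fun x => by rw [hpr_eq]; simp [hv]
  have hprh : ∀ x, hsq (pr x) = hsq x := fun x => by rw [hsq, hsq, hpr0, hpr1]
  have hprc : Continuous pr := by
    rw [show pr = fun x => x - (x 2) • v from funext hpr_eq]
    exact continuous_id.sub ((PiLp.continuous_apply 2 _ (2 : Fin 3)).smul continuous_const)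
  have htf : ∀ x : EuclideanSpace ℝ (Fin 3), ⟪v, x⟫ - 0 = x 2 := fun x => by rw [hvin, sub_zero]
  -- distance of `pr x` to the circle
  have hdist : ∀ x, infDist (pr x) C₀ = |Real.sqrt (hsq x) - 1| := fun x => by
    rw [← hprh x]; exact infDist_circle (hpr2 x)
  have hcth : ∀ x (r : ℝ), |Real.sqrt (hsq x) - 1| ≤ r → pr x ∈ cthickening r C₀ := by
    intro x r hr
    obtain ⟨y, hy, hyd⟩ := hC₀c.exists_infDist_eq_dist hC₀ne (pr x)
    exact mem_cthickening_of_dist_le _ y _ _ hy (by rw [← hyd, hdist]; exact hr)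
  have hnth : ∀ x (r : ℝ), r ≤ |Real.sqrt (hsq x) - 1| → pr x ∉ thickening r C₀ := by
    intro x r hr hmem
    rw [mem_thickening_iff_infDist_lt hC₀ne, hdist] at hmem
    linarith
  have hth : ∀ x (r : ℝ), |Real.sqrt (hsq x) - 1| < r → pr x ∈ thickening r C₀ := by
    intro x r hr
    rw [mem_thickening_iff_infDist_lt hC₀ne, hdist]; exact hr
  have hsqrt_le : ∀ x (b : ℝ), 0 ≤ b → (hsq x ≤ b ^ 2 ↔ Real.sqrt (hsq x) ≤ b) := fun x b hb => by
    constructor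
    · intro h; calc Real.sqrt (hsq x) ≤ Real.sqrt (b ^ 2) := Real.sqrt_le_sqrt h
        _ = b := Real.sqrt_sq hb
    · intro h; have := Real.sq_sqrt (hsq_nonneg x); nlinarith [Real.sqrt_nonneg (hsq x)]
  have hsqrt_lt : ∀ x (b : ℝ), 0 ≤ b → (hsq x < b ^ 2 ↔ Real.sqrt (hsq x) < b) := fun x b hb => by
    constructor
    · intro h; calc Real.sqrt (hsq x) < Real.sqrt (b ^ 2) := Real.sqrt_lt_sqrt (hsq_nonneg x) h
        _ = b := Real.sqrt_sq hb
    · intro h; have := Real.sq_sqrt (hsq_nonneg x); nlinarith [Real.sqrt_nonneg (hsq x)]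
  have hle_sqrt : ∀ x (b : ℝ), 0 ≤ b → (b ^ 2 ≤ hsq x ↔ b ≤ Real.sqrt (hsq x)) := fun x b hb => by
    constructor
    · intro h; calc b = Real.sqrt (b ^ 2) := (Real.sqrt_sq hb).symm
        _ ≤ Real.sqrt (hsq x) := Real.sqrt_le_sqrt h
    · intro h; have := Real.sq_sqrt (hsq_nonneg x); nlinarith [Real.sqrt_nonneg (hsq x)]
  have hlt_sqrt : ∀ x (b : ℝ), 0 ≤ b → (b ^ 2 < hsq x ↔ b < Real.sqrt (hsq x)) := fun x b hb => by
    constructor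
    · intro h; exact lt_of_pow_lt_pow_left₀ 2 (Real.sqrt_nonneg _) (by rw [Real.sq_sqrt (hsq_nonneg x)]; exact h)
    · intro h; have := Real.sq_sqrt (hsq_nonneg x); nlinarith [Real.sqrt_nonneg (hsq x)]
  -- the widths
  set wb : ℝ := min (ρ / 2) (min (ρ₁ / 2) (1 / 2)) with hwb
  have hwb0 : 0 < wb := by rw [hwb]; positivity
  have hwbρ : wb ≤ ρ / 2 := min_le_left _ _
  have hwbρ₁ : wb ≤ ρ₁ / 2 := (min_le_right _ _).trans (min_le_left _ _)
  have hwb1 : wb ≤ 1 / 2 := (min_le_right _ _).trans (min_le_right _ _)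
  set w₀ : ℝ := wb / 6 with hw₀
  have hw₀0 : 0 < w₀ := by positivity
  have hw₀6 : 6 * w₀ = wb := by rw [hw₀]; ring
  -- the zero set of `F₁` is compact; the core height
  have hZ₁c : IsCompact {x | F₁ x = 0} :=
    (hK.cthickening (r := 2 * η / ‖v‖)).of_isClosed_subset (isClosed_eq hF₁s.continuous continuous_const)
      fun x hx => hF₁K x (by rw [show F₁ x = 0 from hx]; exact hε₀.le)
  obtain ⟨ηc, hηc, hcore⟩ : ∃ ηc, 0 < ηc ∧ ∀ x, F₁ x = 0 → hsq x ≤ (1 - 3 * w₀) ^ 2 → ηc < |x 2| := by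
    set S : Set (EuclideanSpace ℝ (Fin 3)) := {x | F₁ x = 0} ∩ {x | hsq x ≤ (1 - 3 * w₀) ^ 2} with hS
    have hSc : IsCompact S := hZ₁c.inter_right (isClosed_le (contDiff_hsq (n := ∞)).continuous continuous_const)
    have hSpos : ∀ x ∈ S, 0 < |x 2| := by
      rintro x ⟨hx0, hxh⟩
      rw [abs_pos]; intro hx2
      have hF0 : F x = 0 := by rw [← hF₁lev x (by rw [hvin, hx2])]; exact hx0
      have hxh' : hsq x ≤ (1 - 3 * w₀) ^ 2 := hxh
      have hw₀s : 3 * w₀ ≤ 1 / 4 := by rw [hw₀]; linarith [hwb1]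
      have h1 : hsq x < 1 := by nlinarith [hsq_nonneg x]
      have := hin x h1 hx2
      rw [hF0, mul_zero] at this; exact lt_irrefl _ this
    by_cases hne : S.Nonempty
    · obtain ⟨x₀, hx₀, hmin⟩ := hSc.exists_isMinOn hne (continuous_abs.comp (PiLp.continuous_apply 2 _ (2 : Fin 3))).continuousOn
      refine ⟨|x₀ 2| / 2, by linarith [hSpos x₀ hx₀], fun x hx hxh => ?_⟩
      have h' : |x₀ 2| ≤ |x 2| := hmin (show x ∈ S from ⟨hx, hxh⟩)
      linarith [hSpos x₀ hx₀]
    · refine ⟨1, one_pos, fun x hx hxh => absurd ⟨x, hx, hxh⟩ hne⟩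
  set η₀ : ℝ := min (η / 2) (ηc / 2) with hη₀
  have hη₀0 : 0 < η₀ := by rw [hη₀]; positivity
  have hη₀η : 2 * η₀ ≤ η := by have := min_le_left (η / 2) (ηc / 2); rw [hη₀]; linarith
  have hη₀c : 2 * η₀ ≤ ηc := by have := min_le_right (η / 2) (ηc / 2); rw [hη₀]; linarith
  -- `F₁ = F ∘ pr` near the wall
  have hin_box : ∀ x, (1 - 6 * w₀) ^ 2 ≤ hsq x → hsq x ≤ (1 + 6 * w₀) ^ 2 → |x 2| ≤ η → F₁ x = F (pr x) := by
    intro x h1 h2 h3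
    refine hF₁in x (hcth x _ ?_) (by rw [htf]; exact h3)
    have hs1 := (hle_sqrt x (1 - 6 * w₀) (by linarith)).1 h1
    have hs2 := (hsqrt_le x (1 + 6 * w₀) (by linarith)).1 h2
    rw [abs_le]; constructor <;> linarith
  -- **the sign pattern of `F₁` on the big tube**
  have hsgn : ∀ x, hsq x ≤ (1 + 6 * w₀) ^ 2 → |x 2| ≤ 2 * η₀ →
      (hsq x < 1 → σ * F₁ x < 0) ∧ (hsq x = 1 → F₁ x = 0) ∧ (1 < hsq x → 0 < σ * F₁ x) := by
    intro x hxh hxz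
    by_cases hcore' : hsq x ≤ (1 - 3 * w₀) ^ 2
    · -- in the core: zero-free, connected, sign at the origin
      have hlt1 : hsq x < 1 := by nlinarith [hsq_nonneg x]
      refine ⟨fun _ => ?_, fun h => absurd h hlt1.ne, fun h => absurd h (not_lt.2 hlt1.le)⟩
      set Core : Set (EuclideanSpace ℝ (Fin 3)) := {y | hsq y ≤ (1 - 3 * w₀) ^ 2 ∧ |y 2| ≤ 2 * η₀} with hCore
      have hconv : Convex ℝ Core := by
        intro a ha b hb t₁ t₂ ht₁ ht₂ hts
        have jensen : ∀ p q : ℝ, (t₁ * p + t₂ * q) ^ 2 ≤ t₁ * p ^ 2 + t₂ * q ^ 2 := by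
          intro p q
          have e : t₂ = 1 - t₁ := by linarith
          rw [e]; nlinarith [mul_nonneg (mul_nonneg ht₁ (by linarith : (0:ℝ) ≤ 1 - t₁)) (sq_nonneg (p - q))]
        refine ⟨?_, ?_⟩
        · show hsq (t₁ • a + t₂ • b) ≤ (1 - 3 * w₀) ^ 2
          have hle : hsq (t₁ • a + t₂ • b) ≤ t₁ * hsq a + t₂ * hsq b := by
            simp only [hsq, PiLp.add_apply, PiLp.smul_apply, smul_eq_mul]
            nlinarith [jensen (a 0) (b 0), jensen (a 1) (b 1)]
          nlinarith [mul_le_mul_of_nonneg_left ha.1 ht₁, mul_le_mul_of_nonneg_left hb.1 ht₂]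
        · show |(t₁ • a + t₂ • b) 2| ≤ 2 * η₀
          simp only [PiLp.add_apply, PiLp.smul_apply, smul_eq_mul]
          calc |t₁ * a 2 + t₂ * b 2| ≤ |t₁ * a 2| + |t₂ * b 2| := abs_add_le _ _
            _ = t₁ * |a 2| + t₂ * |b 2| := by rw [abs_mul, abs_mul, abs_of_nonneg ht₁, abs_of_nonneg ht₂]
            _ ≤ t₁ * (2 * η₀) + t₂ * (2 * η₀) := add_le_add (mul_le_mul_of_nonneg_left ha.2 ht₁) (mul_le_mul_of_nonneg_left hb.2 ht₂)
            _ = 2 * η₀ := by rw [← add_mul, hts, one_mul]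
      have hne0 : ∀ y ∈ Core, σ * F₁ y ≠ 0 := by
        rintro y ⟨hy1, hy2⟩ h
        have hF0 : F₁ y = 0 := by rcases mul_eq_zero.1 h with h | h; exacts [absurd h hσ0, h]
        have := hcore y hF0 hy1; linarith
      have h0mem : (0 : EuclideanSpace ℝ (Fin 3)) ∈ Core := ⟨by simp [hsq]; positivity, by simp; positivity⟩
      have h0neg : σ * F₁ 0 < 0 := by
        rw [hF₁lev 0 (by simp)]; exact hin 0 (by simp [hsq]) (by simp)
      rcases AlexanderTools.forall_pos_or_forall_neg hconv.isPreconnected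
        ((continuous_const.mul hF₁s.continuous).continuousOn) hne0 with h | h
      · exact absurd (h 0 h0mem) (not_lt.2 h0neg.le)
      · exact h x ⟨hcore', hxz⟩
    · -- near the wall: `F₁ = F ∘ pr` and the planar sign pattern
      push Not at hcore'
      have hF₁x : F₁ x = F (pr x) := hin_box x (by nlinarith) hxh (hxz.trans hη₀η)
      rw [hF₁x]
      refine ⟨fun h => hin _ (by rw [hprh]; exact h) (hpr2 x), fun h => hcirc _ (by rw [hprh]; exact h) (hpr2 x),
        fun h => pos_outer hF hcirc hρ₁ hiso hσ hin htr (by rw [hprh]; exact h) (by rw [hprh]; nlinarith) (hpr2 x)⟩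
  -- **the cutoff `θ`**
  obtain ⟨hκ₁s, hκ₁1, hκ₁0⟩ := RegularFamily.plateauCutoff_props (a := (1 + 3 * w₀) ^ 2) (b := (1 + 5 * w₀) ^ 2) (by nlinarith)
  obtain ⟨hκ₂s, hκ₂1, hκ₂0⟩ := RegularFamily.plateauCutoff_props (a := η₀) (b := 3 * η₀ / 2) (by linarith)
  set κ₁ : ℝ → ℝ := fun t => Real.smoothTransition ((t + (1 + 5 * w₀) ^ 2) / ((1 + 5 * w₀) ^ 2 - (1 + 3 * w₀) ^ 2)) *
    Real.smoothTransition (((1 + 5 * w₀) ^ 2 - t) / ((1 + 5 * w₀) ^ 2 - (1 + 3 * w₀) ^ 2)) with hκ₁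
  set κ₂ : ℝ → ℝ := fun t => Real.smoothTransition ((t + 3 * η₀ / 2) / (3 * η₀ / 2 - η₀)) *
    Real.smoothTransition ((3 * η₀ / 2 - t) / (3 * η₀ / 2 - η₀)) with hκ₂
  have hκ₁1' : ∀ t, |t| ≤ (1 + 3 * w₀) ^ 2 → κ₁ t = 1 := hκ₁1
  have hκ₁0' : ∀ t, (1 + 5 * w₀) ^ 2 ≤ |t| → κ₁ t = 0 := hκ₁0
  have hκ₂1' : ∀ t, |t| ≤ η₀ → κ₂ t = 1 := hκ₂1
  have hκ₂0' : ∀ t, 3 * η₀ / 2 ≤ |t| → κ₂ t = 0 := hκ₂0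
  have hκ01 : ∀ t, 0 ≤ κ₁ t ∧ κ₁ t ≤ 1 := fun t =>
    ⟨mul_nonneg (Real.smoothTransition.nonneg _) (Real.smoothTransition.nonneg _),
      mul_le_one₀ (Real.smoothTransition.le_one _) (Real.smoothTransition.nonneg _) (Real.smoothTransition.le_one _)⟩
  have hκ02 : ∀ t, 0 ≤ κ₂ t ∧ κ₂ t ≤ 1 := fun t =>
    ⟨mul_nonneg (Real.smoothTransition.nonneg _) (Real.smoothTransition.nonneg _),
      mul_le_one₀ (Real.smoothTransition.le_one _) (Real.smoothTransition.nonneg _) (Real.smoothTransition.le_one _)⟩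
  set θ : EuclideanSpace ℝ (Fin 3) → ℝ := fun x => κ₁ (hsq x) * κ₂ (x 2) with hθ
  have hc2c : ContDiff ℝ ∞ (fun x : EuclideanSpace ℝ (Fin 3) => x 2) := by
    simpa using (EuclideanSpace.proj (𝕜 := ℝ) (ι := Fin 3) 2).contDiff
  have hθs : ContDiff ℝ ∞ θ := (hκ₁s.comp contDiff_hsq).mul (hκ₂s.comp hc2c)
  have hθ01 : ∀ x, 0 ≤ θ x ∧ θ x ≤ 1 := fun x =>
    ⟨mul_nonneg (hκ01 _).1 (hκ02 _).1, mul_le_one₀ (hκ01 _).2 (hκ02 _).1 (hκ02 _).2⟩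
  have hθ1 : ∀ x, hsq x ≤ (1 + 3 * w₀) ^ 2 → |x 2| ≤ η₀ → θ x = 1 := by
    intro x h1 h2
    show κ₁ (hsq x) * κ₂ (x 2) = 1
    rw [hκ₁1' _ (by rw [abs_of_nonneg (hsq_nonneg x)]; exact h1), hκ₂1' _ h2, one_mul]
  have hθ0 : ∀ x, ((1 + 5 * w₀) ^ 2 ≤ hsq x ∨ 3 * η₀ / 2 ≤ |x 2|) → θ x = 0 := by
    intro x h
    show κ₁ (hsq x) * κ₂ (x 2) = 0
    rcases h with h | h
    · rw [hκ₁0' _ (by rw [abs_of_nonneg (hsq_nonneg x)]; exact h), zero_mul]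
    · rw [hκ₂0' _ h, mul_zero]
  have hθT : ∀ x, θ x ≠ 0 → hsq x < (1 + 5 * w₀) ^ 2 ∧ |x 2| < 3 * η₀ / 2 := by
    intro x h
    by_contra h'
    rw [not_and_or, not_lt, not_lt] at h'
    exact h (hθ0 x h')
  -- off the middle tube `θ` vanishes near the point
  have hθev : ∀ x, ((1 + 5 * w₀) ^ 2 < hsq x ∨ 3 * η₀ / 2 < |x 2|) → ∀ᶠ y in 𝓝 x, θ y = 0 := by
    intro x h
    rcases h with h | h
    · filter_upwards [(isOpen_lt continuous_const (contDiff_hsq (n := ∞)).continuous).mem_nhds h] with y hy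
      exact hθ0 y (Or.inl (le_of_lt hy))
    · filter_upwards [(isOpen_lt continuous_const (continuous_abs.comp (PiLp.continuous_apply 2 _ (2 : Fin 3)))).mem_nhds h]
        with y hy
      exact hθ0 y (Or.inr (le_of_lt hy))
  -- **the modified function**
  set G : EuclideanSpace ℝ (Fin 3) → ℝ := fun x => (1 - θ x) * F₁ x + θ x * (σ * (hsq x - 1)) with hG
  have hGs : ContDiff ℝ ∞ G :=
    ((contDiff_const.sub hθs).mul hF₁s).add (hθs.mul (contDiff_const.mul (contDiff_hsq.sub contDiff_const)))
  have hGθ0 : ∀ x, θ x = 0 → G x = F₁ x := fun x h => by simp only [hG, h]; ring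
  -- the sign agreement `G ∼ F₁`
  have hsame : ∀ x, (G x = 0 ↔ F₁ x = 0) ∧ (G x < 0 ↔ F₁ x < 0) := by
    intro x
    by_cases hθx : θ x = 0
    · rw [hGθ0 x hθx]; exact ⟨Iff.rfl, Iff.rfl⟩
    · obtain ⟨hxh, hxz⟩ := hθT x hθx
      obtain ⟨hneg, hzero, hpos⟩ := hsgn x (by nlinarith) (by linarith)
      have hθpos : 0 < θ x := lt_of_le_of_ne (hθ01 x).1 (Ne.symm hθx)
      have hθle : θ x ≤ 1 := (hθ01 x).2
      have hσG : σ * G x = (1 - θ x) * (σ * F₁ x) + θ x * (hsq x - 1) := by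
        simp only [hG]; have := hσ2; linear_combination (θ x * (hsq x - 1)) * this
      -- helper: from the signs of `σ G` and `σ F₁`
      have key : ∀ {a b : ℝ}, (σ * a < 0 ∧ σ * b < 0) ∨ (a = 0 ∧ b = 0) ∨ (0 < σ * a ∧ 0 < σ * b) →
          (a = 0 ↔ b = 0) ∧ (a < 0 ↔ b < 0) := by
        intro a b h
        rcases hσ with hs | hs <;> subst hs <;> simp only [one_mul, neg_one_mul, neg_lt_zero, neg_pos] at h
        · rcases h with ⟨ha, hb⟩ | ⟨ha, hb⟩ | ⟨ha, hb⟩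
          · exact ⟨⟨fun h => absurd h ha.ne, fun h => absurd h hb.ne⟩, ⟨fun _ => hb, fun _ => ha⟩⟩
          · exact ⟨⟨fun _ => hb, fun _ => ha⟩, ⟨fun h => absurd ha h.ne, fun h => absurd hb h.ne⟩⟩
          · exact ⟨⟨fun h => absurd h ha.ne', fun h => absurd h hb.ne'⟩, ⟨fun h => absurd h (not_lt.2 ha.le), fun h => absurd h (not_lt.2 hb.le)⟩⟩
        · rcases h with ⟨ha, hb⟩ | ⟨ha, hb⟩ | ⟨ha, hb⟩
          · exact ⟨⟨fun h => absurd h ha.ne', fun h => absurd h hb.ne'⟩, ⟨fun h => absurd h (not_lt.2 ha.le), fun h => absurd h (not_lt.2 hb.le)⟩⟩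
          · exact ⟨⟨fun _ => hb, fun _ => ha⟩, ⟨fun h => absurd ha h.ne, fun h => absurd hb h.ne⟩⟩
          · exact ⟨⟨fun h => absurd h ha.ne, fun h => absurd h hb.ne⟩, ⟨fun _ => hb, fun _ => ha⟩⟩
      apply key
      rcases lt_trichotomy (hsq x) 1 with hlt | heq | hgt
      · left
        refine ⟨?_, hneg hlt⟩
        rw [hσG]
        have h1 : (1 - θ x) * (σ * F₁ x) ≤ 0 := mul_nonpos_of_nonneg_of_nonpos (by linarith) (hneg hlt).le
        have h2 : θ x * (hsq x - 1) < 0 := mul_neg_of_pos_of_neg hθpos (by linarith)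
        linarith
      · right; left
        refine ⟨?_, hzero heq⟩
        simp only [hG, hzero heq, heq]; ring
      · right; right
        refine ⟨?_, hpos hgt⟩
        rw [hσG]
        have h1 : 0 ≤ (1 - θ x) * (σ * F₁ x) := mul_nonneg (by linarith) (hpos hgt).le
        have h2 : 0 < θ x * (hsq x - 1) := mul_pos hθpos (by linarith)
        linarith
  have hsetle : {x | G x ≤ 0} = {x | F₁ x ≤ 0} := by
    ext x; simp only [mem_setOf_eq, le_iff_lt_or_eq, (hsame x).1, (hsame x).2]
  have hseteq : {x | G x = 0} = {x | F₁ x = 0} := by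
    ext x; exact (hsame x).1
  -- **the derivative of `G` at a wall zero**
  have hwall_deriv : ∀ x, hsq x = 1 → |x 2| < η → σ * fderiv ℝ G x (pr x) = (1 - θ x) * (σ * fderiv ℝ F (pr x) (pr x)) + 2 * θ x ∧
      0 < σ * fderiv ℝ F (pr x) (pr x) := by
    intro x hx1 hxz
    have hc : hsq (pr x) = 1 := by rw [hprh, hx1]
    have hc2 : (pr x) 2 = 0 := hpr2 x
    -- `F₁ = F ∘ pr` near `x`
    have hev : F₁ =ᶠ[𝓝 x] fun y => F (pr y) := by
      have ho1 : IsOpen {y : EuclideanSpace ℝ (Fin 3) | (1 - 6 * w₀) ^ 2 < hsq y ∧ hsq y < (1 + 6 * w₀) ^ 2 ∧ |y 2| < η} :=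
        (isOpen_lt continuous_const (contDiff_hsq (n := ∞)).continuous).inter
          ((isOpen_lt (contDiff_hsq (n := ∞)).continuous continuous_const).inter
            (isOpen_lt (continuous_abs.comp (PiLp.continuous_apply 2 _ (2 : Fin 3))) continuous_const))
      filter_upwards [ho1.mem_nhds ⟨by rw [hx1]; nlinarith, by rw [hx1]; nlinarith, hxz⟩] with y hy
      exact hin_box y hy.1.le hy.2.1.le hy.2.2.le
    have hDF₁ : fderiv ℝ F₁ x = (fderiv ℝ F (pr x)).comp
        (ContinuousLinearMap.id ℝ _ - (‖v‖ ^ 2)⁻¹ • (innerSL ℝ v).smulRight v) := by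
      rw [hev.fderiv_eq]
      exact ((hFd (pr x)).hasFDerivAt.comp x (Verticalise.hasFDerivAt_proj v 0 x)).fderiv
    have hDF₁r : fderiv ℝ F₁ x (pr x) = fderiv ℝ F (pr x) (pr x) := by
      rw [hDF₁, ContinuousLinearMap.comp_apply, Verticalise.proj_deriv_apply_of_inner_eq_zero (by rw [hvin, hc2])]
    -- product rule for `G` at `x` (where `F₁ x = 0` and `hsq x - 1 = 0`)
    have hF₁x : F₁ x = 0 := by
      rw [hev.eq_of_nhds]; exact hcirc _ hc hc2
    have hθd : DifferentiableAt ℝ θ x := (hθs.differentiable (by simp)) x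
    have hF₁d : DifferentiableAt ℝ F₁ x := (hF₁s.differentiable (by simp)) x
    have hhd : DifferentiableAt ℝ hsq x := (hasFDerivAt_hsq x).differentiableAt
    have hDG : fderiv ℝ G x = (1 - θ x) • fderiv ℝ F₁ x + F₁ x • ((0 : EuclideanSpace ℝ (Fin 3) →L[ℝ] ℝ) - fderiv ℝ θ x) +
        (θ x • (σ • dhsq x) + (σ * (hsq x - 1)) • fderiv ℝ θ x) := by
      have h1 : HasFDerivAt (fun y => (1 - θ y) * F₁ y)
          ((1 - θ x) • fderiv ℝ F₁ x + F₁ x • ((0 : EuclideanSpace ℝ (Fin 3) →L[ℝ] ℝ) - fderiv ℝ θ x)) x :=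
        ((hasFDerivAt_const (1 : ℝ) x).sub hθd.hasFDerivAt).mul hF₁d.hasFDerivAt
      have hh : HasFDerivAt (fun y => σ * (hsq y - 1)) (σ • dhsq x) x :=
        ((hasFDerivAt_hsq x).sub_const 1).const_mul σ
      have h2 : HasFDerivAt (fun y => θ y * (σ * (hsq y - 1)))
          (θ x • (σ • dhsq x) + (σ * (hsq x - 1)) • fderiv ℝ θ x) x := hθd.hasFDerivAt.mul hh
      exact (h1.add h2).fderiv
    have hdh : dhsq x (pr x) = 2 := by
      rw [dhsq_apply, hpr0, hpr1]; rw [hsq] at hx1; linear_combination 2 * hx1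
    refine ⟨?_, radial_pos hF hcirc hρ₁ hiso hσ hin htr hc hc2⟩
    have happly : fderiv ℝ G x (pr x) = (1 - θ x) * fderiv ℝ F (pr x) (pr x) + θ x * (σ * 2) := by
      rw [hDG, hF₁x, hx1]
      simp [hDF₁r, hdh]
    rw [happly]
    have := hσ2
    linear_combination (2 * θ x) * this
  -- regularity and non-horizontality of `G` at wall zeros
  have hwall_reg : ∀ x, hsq x = 1 → |x 2| < η → ∀ c : ℝ, fderiv ℝ G x ≠ c • innerSL ℝ v := by
    intro x hx1 hxz c hc
    obtain ⟨hformula, hrad⟩ := hwall_deriv x hx1 hxz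
    have hpos : 0 < σ * fderiv ℝ G x (pr x) := by
      rw [hformula]
      rcases (hθ01 x).1.lt_or_eq with h | h
      · have : 0 ≤ (1 - θ x) * (σ * fderiv ℝ F (pr x) (pr x)) := mul_nonneg (by linarith [(hθ01 x).2]) hrad.le
        linarith
      · rw [← h]; simpa using hrad
    have hzero : fderiv ℝ G x (pr x) = 0 := by
      rw [hc]; simp [hvin, hpr2]
    rw [hzero, mul_zero] at hpos; exact lt_irrefl _ hpos
  -- **the modification zone**
  set Rbar : Set (EuclideanSpace ℝ (Fin 3)) := {x | pr x ∈ cthickening ρ C₀ ∧ |x 2| ≤ 2 * η} with hRbar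
  set Tbig : Set (EuclideanSpace ℝ (Fin 3)) := {x | hsq x ≤ (1 + 6 * w₀) ^ 2 ∧ |x 2| ≤ 2 * η₀} with hTbig
  have hRbarc : IsClosed Rbar :=
    (isClosed_cthickening.preimage hprc).inter (isClosed_le (continuous_abs.comp (PiLp.continuous_apply 2 _ (2 : Fin 3))) continuous_const)
  have hTbigcl : IsClosed Tbig :=
    (isClosed_le (contDiff_hsq (n := ∞)).continuous continuous_const).inter
      (isClosed_le (continuous_abs.comp (PiLp.continuous_apply 2 _ (2 : Fin 3))) continuous_const)
  have hTbigc : IsCompact Tbig := by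
    refine Metric.isCompact_of_isClosed_isBounded hTbigcl ?_
    refine (Metric.isBounded_closedBall (x := (0 : EuclideanSpace ℝ (Fin 3))) (r := (1 + 6 * w₀) + 2 * η₀)).subset ?_
    rintro x ⟨h1, h2⟩
    rw [mem_closedBall_zero_iff, EuclideanSpace.norm_eq]
    have hsum : ∑ i : Fin 3, x i ^ 2 = hsq x + (x 2) ^ 2 := by simp [Fin.sum_univ_three, hsq]
    simp only [Real.norm_eq_abs, sq_abs]
    rw [hsum]
    calc Real.sqrt (hsq x + x 2 ^ 2) ≤ Real.sqrt (((1 + 6 * w₀) + 2 * η₀) ^ 2) := by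
          apply Real.sqrt_le_sqrt
          have : x 2 ^ 2 ≤ (2 * η₀) ^ 2 := by rw [← sq_abs]; exact pow_le_pow_left₀ (abs_nonneg _) h2 2
          nlinarith
      _ = (1 + 6 * w₀) + 2 * η₀ := Real.sqrt_sq (by positivity)
  -- `F` has no horizontal zeros in the zone
  have hFzone : ∀ x ∈ Rbar ∪ Tbig, F x = 0 → ∀ c : ℝ, fderiv ℝ F x ≠ c • innerSL ℝ v := by
    intro x hx hFx c
    by_cases hR : pr x ∈ cthickening ρ C₀ ∧ |x 2| ≤ 2 * η
    · exact hFtr x hR.1 (by rw [htf]; exact hR.2) c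
    · exfalso
      rcases hx with hx | ⟨hxh, hxz⟩
      · exact hR hx
      -- in the big tube but off the closed box: deep in the core, where `F = F₁ ≠ 0`
      have hfar : ¬ pr x ∈ cthickening ρ C₀ := fun h => hR ⟨h, hxz.trans (by linarith)⟩
      have hρlt : ρ < |Real.sqrt (hsq x) - 1| := by
        by_contra hle; push Not at hle; exact hfar (hcth x ρ hle)
      have hs2 := (hsqrt_le x (1 + 6 * w₀) (by linarith)).1 hxh
      have hinside : Real.sqrt (hsq x) < 1 - 3 * w₀ := by
        rcases le_or_gt (Real.sqrt (hsq x)) 1 with h | h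
        · rw [abs_of_nonpos (by linarith)] at hρlt; linarith
        · rw [abs_of_pos (by linarith)] at hρlt; linarith
      have hcore_mem : hsq x ≤ (1 - 3 * w₀) ^ 2 := by
        have := Real.sq_sqrt (hsq_nonneg x); nlinarith [Real.sqrt_nonneg (hsq x)]
      have hout : pr x ∉ thickening ρ C₀ := fun h => hfar (thickening_subset_cthickening _ _ h)
      have hF₁x : F₁ x = F x := hF₁out x (Or.inl hout)
      have := hcore x (by rw [hF₁x]; exact hFx) hcore_mem
      linarith
  refine ⟨G, Φ, w₀, η₀, cthickening (2 * η / ‖v‖) K ∪ Tbig, Rbar ∪ Tbig, hw₀0, hη₀0, hGs,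
    (hK.cthickening).union hTbigc, fun x hx => ?_, fun x hx => ?_, by rw [hΦle, hsetle], by rw [hΦeq, hseteq],
    fun x h1 h2 => ?_, fun x hx2 => ?_, hRbarc.union hTbigcl, fun x hx => ?_, fun x hx => ?_, hFzone, fun x hx hGx c => ?_⟩
  · -- properness
    by_cases hθx : θ x = 0
    · exact Or.inl (hF₁K x (by rw [← hGθ0 x hθx]; exact hx))
    · obtain ⟨h1, h2⟩ := hθT x hθx
      exact Or.inr ⟨by nlinarith, by linarith⟩
  · -- regularity
    have hF₁x : F₁ x = 0 := (hsame x).1.1 hx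
    by_cases hpos : (1 + 5 * w₀) ^ 2 < hsq x ∨ 3 * η₀ / 2 < |x 2|
    · have hev : G =ᶠ[𝓝 x] F₁ := by
        filter_upwards [hθev x hpos] with y hy using hGθ0 y hy
      rw [hev.fderiv_eq]; exact hF₁reg x hF₁x
    · rw [not_or, not_lt, not_lt] at hpos
      have hx1 : hsq x = 1 := by
        obtain ⟨hneg, -, hpos'⟩ := hsgn x (by nlinarith [hpos.1]) (by linarith [hpos.2])
        rcases lt_trichotomy (hsq x) 1 with h | h | h
        · have := hneg h; rw [hF₁x, mul_zero] at this; exact absurd this (lt_irrefl _)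
        · exact h
        · have := hpos' h; rw [hF₁x, mul_zero] at this; exact absurd this (lt_irrefl _)
      intro h0
      exact hwall_reg x hx1 (by linarith [hpos.2]) 0 (by rw [h0, zero_smul])
  · -- the normal form on the tube
    simp only [hG, hθ1 x h1 h2]; ring
  · -- the level `0` is unchanged
    rw [(hsame x).1, hF₁lev x (by rw [hvin, hx2])]
  · -- `Φ = id` off the zone
    apply hΦout
    by_contra h'
    rw [not_or, not_not, not_le] at h'
    exact hx (Or.inl ⟨thickening_subset_cthickening _ _ h'.1, by have h2 := h'.2; rw [htf] at h2; exact h2.le⟩)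
  · -- `G = F` off the zone
    have hθx : θ x = 0 := by
      apply hθ0
      by_contra h'
      rw [not_or, not_le, not_le] at h'
      exact hx (Or.inr ⟨by nlinarith [h'.1], by linarith [h'.2]⟩)
    rw [hGθ0 x hθx]
    apply hF₁out
    by_contra h'
    rw [not_or, not_not, not_le] at h'
    exact hx (Or.inl ⟨thickening_subset_cthickening _ _ h'.1, by have h2 := h'.2; rw [htf] at h2; exact h2.le⟩)
  · -- `G` has no horizontal zeros in the zone
    have hF₁x : F₁ x = 0 := (hsame x).1.1 hGx
    by_cases hpos : (1 + 5 * w₀) ^ 2 < hsq x ∨ 3 * η₀ / 2 < |x 2|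
    · have hev : G =ᶠ[𝓝 x] F₁ := by
        filter_upwards [hθev x hpos] with y hy using hGθ0 y hy
      rw [hev.fderiv_eq]
      by_cases hR : pr x ∈ thickening ρ C₀ ∧ |x 2| < 2 * η
      · exact hF₁tr x hR.1 (by rw [htf]; exact hR.2) hF₁x c
      · have hout : pr x ∉ thickening ρ C₀ ∨ 2 * η ≤ |⟪v, x⟫ - 0| := by
          rw [htf]; by_contra h'; rw [not_or, not_not, not_le] at h'; exact hR h'
        rw [hF₁Dout x hout]
        exact hFzone x hx (by rw [← hF₁out x hout]; exact hF₁x) c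
    · rw [not_or, not_lt, not_lt] at hpos
      have hx1 : hsq x = 1 := by
        obtain ⟨hneg, -, hpos'⟩ := hsgn x (by nlinarith [hpos.1]) (by linarith [hpos.2])
        rcases lt_trichotomy (hsq x) 1 with h | h | h
        · have := hneg h; rw [hF₁x, mul_zero] at this; exact absurd this (lt_irrefl _)
        · exact h
        · have := hpos' h; rw [hF₁x, mul_zero] at this; exact absurd this (lt_irrefl _)
      exact hwall_reg x hx1 (by linarith [hpos.2]) c

end Literature.Topology.FourManifolds.CircleNormalForm
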